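import Mathlib.Analysis.Calculus.MeanValue
import Mathlib.Analysis.Normed.Operator.Prod
import Mathlib.Analysis.Calculus.BumpFunction.FiniteDimension
import Mathlib.Analysis.Calculus.InverseFunctionTheorem.FDeriv
import Mathlib.Analysis.Calculus.InverseFunctionTheorem.ContDiff
import Mathlib.Analysis.SpecialFunctions.SmoothTransition
import Mathlib.Analysis.InnerProductSpace.PiL2
import Mathlib.Topology.Algebra.Module.FiniteDimension
import HarnessLib

/-!
# Straightening a map tangent to the identity along a segment; smooth inverses on open sets

Topic `Literature/Topology/FourManifolds`; general analysis for the proof programme of the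
Fox–Milnor fact `Literature.Topology.FourManifolds.Knot.exists_isConnectedSum_isConcordant`
(flattening a long annulus along its axis, `LongAnnulusFlatten.lean`). Everything here is proved;
no named fact is introduced.

* `isOpen_image_and_contDiffOn_symm_of_injOn` — for finite-dimensional spaces of equal dimension:
  a `C^∞` map injective on an open set `O` with injective differential there has open image and
  `C^∞` inverse on it (inverse function theorem at each point; the local inverses agree with the
  global one by injectivity). The general form of `ArcTube.isOpen_image_and_contDiffOn_invFunOn`.
* `injective_add_of_norm_fderiv_le`, `injective_fderiv_add_of_norm_fderiv_le` — `id + p` is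
  injective with injective differential when `‖Dp‖ ≤ 1/2` (mean value inequality; Hirsch (1976),
  Ch. 2 §1, Lemma 1.3).
* `exists_straighten_near_axis` — **straightening along a segment**: let `Φ` be `C^∞` on an open
  `V ⊆ ℝ³ × ℝ` containing the segment `{x₀} × [a - 3, b + 3]`, with `Φ = id` and `DΦ = id` on
  it. Then for every `r₀ > 0` there are `0 < r ≤ r₀` and a `C^∞` cut-off `κ : ℝ³ × ℝ → [0, 1]`
  (`χ ((x - x₀)/r) · ρ t`), equal to `1` on `B̄(x₀, r) × [a - 1, b + 1]` and vanishing off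
  `B(x₀, 2r) × (a - 5/2, b + 5/2)` (a tube inside `V`), such that **`G y = y + κ y • (Φ y - y)` is
  `C^∞`, injective, with injective differential** (`‖D(κ • (Φ - id))‖ ≤ 1/2`: `‖D(Φ - id)‖` is
  small near the segment, `‖Φ y - y‖ ≤ ε ‖y.1 - x₀‖` by the mean value inequality, and
  `‖Dκ‖ ≤ C/r + C'`). The segment version of the tree's
  `exists_diffeomorph_eq_of_fderiv_eq_id` (`CompactlySupportedDiffeo.lean`), with the
  interpolation form of `G` recorded (so that `G` fixes the fixed points of `Φ` and moves levels by
  convex combination).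

## References

* M. W. Hirsch, *Differential Topology*, GTM 33 (1976), Ch. 2 §1 (Lemma 1.3), Ch. 8 §3 (proof of
  Thm. 3.1). [HirschDT1976]

## Design notes

No named facts, no `sorry`; `𝔼 n` is local notation as in `Knots.lean`.
-/

open scoped Topology ContDiff
open Function Set Metric Filter

noncomputable section

namespace Literature.Topology.FourManifolds

/-- Local notation: `𝔼 n` is the model Euclidean space `EuclideanSpace ℝ (Fin n)`. -/
local notation "𝔼 " n:arg => EuclideanSpace ℝ (Fin n)

/-! ### Smooth inverses of injective local diffeomorphisms on open sets -/

section LocalInverse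

variable {E' F' : Type*} [NormedAddCommGroup E'] [NormedSpace ℝ E'] [FiniteDimensional ℝ E']
  [CompleteSpace E'] [NormedAddCommGroup F'] [NormedSpace ℝ F'] [FiniteDimensional ℝ F']

omit [CompleteSpace E'] in
/-- In equal finite dimension, an injective differential is a strict derivative which is a linear
isomorphism. [folklore] -/
theorem exists_equiv_hasStrictFDerivAt_of_injective (hdim : Module.finrank ℝ E' = Module.finrank ℝ F')
    {f : E' → F'} (hf : ContDiff ℝ ∞ f) {p : E'} (hinj : Injective (fderiv ℝ f p)) :
    ∃ L : E' ≃L[ℝ] F', (L : E' →L[ℝ] F') = fderiv ℝ f p ∧ HasStrictFDerivAt f (L : E' →L[ℝ] F') p := by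
  set L : E' ≃L[ℝ] F' :=
    (LinearMap.linearEquivOfInjective (fderiv ℝ f p).toLinearMap hinj hdim).toContinuousLinearEquiv with hL
  have hLe : (L : E' →L[ℝ] F') = fderiv ℝ f p := by
    refine ContinuousLinearMap.ext fun v ↦ ?_
    simp [hL]
  refine ⟨L, hLe, ?_⟩
  rw [hLe]
  exact hf.contDiffAt.hasStrictFDerivAt (by simp)

/-- **On an open set where a smooth map between spaces of equal finite dimension is injective with
injective differential, its image is open and its inverse is smooth** (inverse function theorem
at each point; the local inverses agree with the global one by injectivity). [folklore] -/
theorem isOpen_image_and_contDiffOn_symm_of_injOn [Nonempty E']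
    (hdim : Module.finrank ℝ E' = Module.finrank ℝ F') {f : E' → F'} (hf : ContDiff ℝ ∞ f)
    {O : Set E'} (hO : IsOpen O) (hinjO : InjOn f O) (hder : ∀ p ∈ O, Injective (fderiv ℝ f p)) :
    IsOpen (f '' O) ∧ ContDiffOn ℝ ∞ (hinjO.toPartialEquiv f O).symm (f '' O) ∧
      ∀ p ∈ O, (hinjO.toPartialEquiv f O).symm (f p) = p := by
  set G := (hinjO.toPartialEquiv f O).symm with hG
  have hGleft : ∀ p ∈ O, G (f p) = p := fun p hp ↦ (hinjO.toPartialEquiv f O).left_inv hp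
  have key : ∀ p ∈ O, ∃ S : Set F', IsOpen S ∧ f p ∈ S ∧ S ⊆ f '' O ∧ ContDiffOn ℝ ∞ G S := by
    intro p hp
    obtain ⟨L, hLe, hstrict⟩ := exists_equiv_hasStrictFDerivAt_of_injective hdim hf (hder p hp)
    set e := hstrict.toOpenPartialHomeomorph f with he
    have hecoe : (e : E' → F') = f := hstrict.toOpenPartialHomeomorph_coe
    have hps : p ∈ e.source := hstrict.mem_toOpenPartialHomeomorph_source
    set S : Set F' := e '' (e.source ∩ O) with hS
    have hSo : IsOpen S := e.isOpen_image_of_subset_source (e.open_source.inter hO) inter_subset_left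
    have hpS : f p ∈ S := ⟨p, ⟨hps, hp⟩, by rw [hecoe]⟩
    have hSsub : S ⊆ f '' O := by
      rintro _ ⟨q, ⟨-, hq⟩, rfl⟩
      exact ⟨q, hq, by rw [hecoe]⟩
    refine ⟨S, hSo, hpS, hSsub, ?_⟩
    have hGe : ∀ y ∈ S, G y = e.symm y := by
      rintro _ ⟨q, ⟨hqs, hqO⟩, rfl⟩
      rw [hecoe, hGleft q hqO]
      have := e.left_inv hqs
      rw [hecoe] at this
      exact this.symm
    intro y hy
    have hy' : y ∈ e.target := by
      obtain ⟨q, ⟨hqs, -⟩, rfl⟩ := hy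
      exact e.map_source hqs
    have hsymm : ContDiffAt ℝ ∞ e.symm y := by
      have hqO : e.symm y ∈ O := by
        obtain ⟨q, ⟨hqs, hqO⟩, rfl⟩ := hy
        rwa [e.left_inv hqs]
      obtain ⟨L', hL'e, hstrict'⟩ := exists_equiv_hasStrictFDerivAt_of_injective hdim hf (hder _ hqO)
      refine e.contDiffAt_symm hy' (f₀' := L') ?_ ?_
      · rw [hecoe]; exact hstrict'.hasFDerivAt
      · rw [hecoe]; exact hf.contDiffAt
    refine (hsymm.congr_of_eventuallyEq ?_).contDiffWithinAt
    filter_upwards [hSo.mem_nhds hy] with z hz using hGe z hz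
  refine ⟨?_, ?_, hGleft⟩
  · rw [isOpen_iff_mem_nhds]
    rintro _ ⟨p, hp, rfl⟩
    obtain ⟨S, hSo, hpS, hSsub, -⟩ := key p hp
    exact mem_of_superset (hSo.mem_nhds hpS) hSsub
  · rintro _ ⟨p, hp, rfl⟩
    obtain ⟨S, hSo, hpS, hSsub, hGS⟩ := key p hp
    exact (hGS.contDiffAt (hSo.mem_nhds hpS)).contDiffWithinAt

end LocalInverse

/-! ### `id + p` with `‖Dp‖ ≤ 1/2` -/

section SmallPerturbation

variable {E : Type*} [NormedAddCommGroup E] [NormedSpace ℝ E]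

/-- `id + p` is injective when `‖Dp‖ ≤ 1/2` (mean value inequality). Hirsch (1976), Ch. 2 §1,
Lemma 1.3. [folklore] -/
theorem injective_add_of_norm_fderiv_le {p : E → E} (hp : Differentiable ℝ p)
    (hb : ∀ y, ‖fderiv ℝ p y‖ ≤ 1 / 2) : Injective fun y ↦ y + p y := by
  intro x y hxy
  have hlip : ‖p x - p y‖ ≤ 1 / 2 * ‖x - y‖ :=
    (convex_univ).norm_image_sub_le_of_norm_fderiv_le (fun z _ ↦ hp z) (fun z _ ↦ hb z)
      (mem_univ y) (mem_univ x)
  have hxy0 : x + p x = y + p y := hxy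
  have h1 : x - y = p y - p x := by
    rw [sub_eq_sub_iff_add_eq_add]
    exact hxy0.trans (add_comm _ _)
  have h2 : ‖x - y‖ ≤ 1 / 2 * ‖x - y‖ := by
    calc ‖x - y‖ = ‖p x - p y‖ := by rw [h1, norm_sub_rev]
      _ ≤ 1 / 2 * ‖x - y‖ := hlip
  have h0 : ‖x - y‖ = 0 := by linarith [norm_nonneg (x - y)]
  exact sub_eq_zero.1 (norm_eq_zero.1 h0)

/-- `id + p` has injective differential when `‖Dp‖ ≤ 1/2`. [folklore] -/
theorem injective_fderiv_add_of_norm_fderiv_le {p : E → E} (hp : Differentiable ℝ p)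
    (hb : ∀ y, ‖fderiv ℝ p y‖ ≤ 1 / 2) (y : E) : Injective (fderiv ℝ (fun y ↦ y + p y) y) := by
  have h : HasFDerivAt (fun y ↦ y + p y) (ContinuousLinearMap.id ℝ E + fderiv ℝ p y) y :=
    (hasFDerivAt_id y).add (hp y).hasFDerivAt
  rw [h.fderiv]
  refine (injective_iff_map_eq_zero _).2 fun v hv ↦ ?_
  have hv2 : v + fderiv ℝ p y v = 0 := hv
  have hv' : v = -(fderiv ℝ p y v) := eq_neg_of_add_eq_zero_left hv2
  have h1 : ‖v‖ ≤ 1 / 2 * ‖v‖ := by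
    conv_lhs => rw [hv']
    rw [norm_neg]
    exact (ContinuousLinearMap.le_opNorm _ _).trans (mul_le_mul_of_nonneg_right (hb y) (norm_nonneg v))
  have h0 : ‖v‖ = 0 := by linarith [norm_nonneg v]
  exact norm_eq_zero.1 h0

end SmallPerturbation

/-! ### A one-variable cut-off and the bounded derivative of functions supported in an interval -/

/-- A `C¹` function vanishing on `(-∞, a]` and on `[b, ∞)` has bounded derivative. [folklore] -/
theorem exists_abs_deriv_le_of_eq_zero {B : ℝ → ℝ} (hB : ContDiff ℝ 1 B) {a b : ℝ}
    (ha : ∀ t, t ≤ a → B t = 0) (hb : ∀ t, b ≤ t → B t = 0) :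
    ∃ K : ℝ, 0 < K ∧ ∀ t, |deriv B t| ≤ K := by
  have hd : Continuous (deriv B) := hB.continuous_deriv le_rfl
  obtain ⟨K, hK⟩ := isCompact_Icc.exists_bound_of_continuousOn (s := Icc a b) hd.continuousOn
  refine ⟨max K 1, by positivity, fun t ↦ ?_⟩
  by_cases ht : t ∈ Icc a b
  · exact ((Real.norm_eq_abs _).symm.le.trans (hK t ht)).trans (le_max_left _ _)
  · have hzero : deriv B t = 0 := by
      rcases not_and_or.1 ht with h | h
      · have hev : B =ᶠ[𝓝 t] fun _ ↦ (0 : ℝ) := by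
          filter_upwards [Iio_mem_nhds (not_le.1 h)] with s hs using ha s (mem_Iio.1 hs).le
        rw [hev.deriv_eq, deriv_const]
      · have hev : B =ᶠ[𝓝 t] fun _ ↦ (0 : ℝ) := by
          filter_upwards [Ioi_mem_nhds (not_le.1 h)] with s hs using hb s (mem_Ioi.1 hs).le
        rw [hev.deriv_eq, deriv_const]
    rw [hzero, abs_zero]; positivity

/-- A one-variable cut-off which is `1` on `[a - 1, b + 1]` and `0` off `(a - 5/2, b + 5/2)`
differs from its value at `a` also... (the `ρ` of `exists_straighten_near_axis`). [folklore] -/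
def segCutoff (a b t : ℝ) : ℝ :=
  Real.smoothTransition ((t - (a - 5 / 2)) / (3 / 2)) * Real.smoothTransition (((b + 5 / 2) - t) / (3 / 2))

/-- The cut-off is `C^∞`. [folklore] -/
theorem contDiff_segCutoff (a b : ℝ) : ContDiff ℝ ∞ (segCutoff a b) :=
  (Real.smoothTransition.contDiff.comp ((contDiff_id.sub contDiff_const).div_const _)).mul
    (Real.smoothTransition.contDiff.comp ((contDiff_const.sub contDiff_id).div_const _))

/-- `0 ≤ segCutoff ≤ 1`. [folklore] -/
theorem segCutoff_mem_Icc (a b t : ℝ) : segCutoff a b t ∈ Icc (0 : ℝ) 1 :=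
  ⟨mul_nonneg (Real.smoothTransition.nonneg _) (Real.smoothTransition.nonneg _),
    mul_le_one₀ (Real.smoothTransition.le_one _) (Real.smoothTransition.nonneg _)
      (Real.smoothTransition.le_one _)⟩

/-- The cut-off is `1` on `[a - 1, b + 1]`. [folklore] -/
theorem segCutoff_eq_one {a b t : ℝ} (ht : t ∈ Icc (a - 1) (b + 1)) : segCutoff a b t = 1 := by
  rw [segCutoff, Real.smoothTransition.one_of_one_le, Real.smoothTransition.one_of_one_le, one_mul]
  · rw [le_div_iff₀ (by norm_num)]; linarith [ht.2]
  · rw [le_div_iff₀ (by norm_num)]; linarith [ht.1]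

/-- The cut-off vanishes for `t ≤ a - 5/2`. [folklore] -/
theorem segCutoff_of_le {a b t : ℝ} (ht : t ≤ a - 5 / 2) : segCutoff a b t = 0 := by
  rw [segCutoff, Real.smoothTransition.zero_of_nonpos, zero_mul]
  exact div_nonpos_of_nonpos_of_nonneg (by linarith) (by norm_num)

/-- The cut-off vanishes for `t ≥ b + 5/2`. [folklore] -/
theorem segCutoff_of_ge {a b t : ℝ} (ht : b + 5 / 2 ≤ t) : segCutoff a b t = 0 := by
  rw [segCutoff, Real.smoothTransition.zero_of_nonpos (x := ((b + 5 / 2) - t) / (3 / 2)), mul_zero]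
  exact div_nonpos_of_nonpos_of_nonneg (by linarith) (by norm_num)

/-- Where the cut-off does not vanish, `t ∈ (a - 5/2, b + 5/2)`. [folklore] -/
theorem mem_Ioo_of_segCutoff_ne_zero {a b t : ℝ} (h : segCutoff a b t ≠ 0) :
    t ∈ Ioo (a - 5 / 2) (b + 5 / 2) := by
  constructor
  · by_contra h'; exact h (segCutoff_of_le (not_lt.1 h'))
  · by_contra h'; exact h (segCutoff_of_ge (not_lt.1 h'))

/-! ### Straightening along a segment -/

/-- **Straightening a map tangent to the identity along a segment.** Let `Φ` be `C^∞` on an open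
set `V ⊆ ℝ³ × ℝ` containing the segment `{x₀} × [a - 3, b + 3]`, with `Φ (x₀, t) = (x₀, t)`
and `DΦ (x₀, t) = id` for `t ∈ [a - 3, b + 3]`. Then for every `r₀ > 0` there are `0 < r ≤ r₀`
with `B̄(x₀, 2r) × [a - 5/2, b + 5/2] ⊆ V` and a `C^∞` cut-off `κ` with values in `[0, 1]`, equal
to `1` on `B̄(x₀, r) × [a - 1, b + 1]` and nonzero only on `B(x₀, 2r) × (a - 5/2, b + 5/2)`, such
that `G y = y + κ y • (Φ y - y)` is `C^∞`, injective, with injective differential everywhere.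
(Hirsch (1976), Ch. 8 §3, proof of Thm. 3.1, first step — along a segment instead of at a point:
`‖D(Φ - id)‖ ≤ ε` on a tube around the segment, `‖Φ y - y‖ ≤ ε ‖y.1 - x₀‖` there by the mean
value inequality, `‖Dκ‖ ≤ C/r + C'`, whence `‖D(κ • (Φ - id))‖ ≤ 1/2`.) [folklore] -/
theorem exists_straighten_near_axis (x₀ : 𝔼 3) {a b : ℝ} {V : Set (𝔼 3 × ℝ)}
    (hV : IsOpen V) (hK : ∀ t ∈ Icc (a - 3) (b + 3), ((x₀, t) : 𝔼 3 × ℝ) ∈ V)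
    {Φ : 𝔼 3 × ℝ → 𝔼 3 × ℝ} (hΦ : ContDiffOn ℝ ∞ Φ V)
    (hΦid : ∀ t ∈ Icc (a - 3) (b + 3), Φ (x₀, t) = (x₀, t))
    (hDΦ : ∀ t ∈ Icc (a - 3) (b + 3), fderiv ℝ Φ (x₀, t) = ContinuousLinearMap.id ℝ (𝔼 3 × ℝ))
    {r₀ : ℝ} (hr₀ : 0 < r₀) :
    ∃ (r : ℝ) (κ : 𝔼 3 × ℝ → ℝ), 0 < r ∧ r ≤ r₀ ∧
      closedBall x₀ (2 * r) ×ˢ Icc (a - 5 / 2) (b + 5 / 2) ⊆ V ∧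
      ContDiff ℝ ∞ κ ∧ (∀ y, κ y ∈ Icc (0 : ℝ) 1) ∧
      (∀ y : 𝔼 3 × ℝ, y.1 ∈ closedBall x₀ r → y.2 ∈ Icc (a - 1) (b + 1) → κ y = 1) ∧
      (∀ y : 𝔼 3 × ℝ, κ y ≠ 0 → y.1 ∈ ball x₀ (2 * r) ∧ y.2 ∈ Ioo (a - 5 / 2) (b + 5 / 2)) ∧
      ContDiff ℝ ∞ (fun y ↦ y + κ y • (Φ y - y)) ∧ Injective (fun y ↦ y + κ y • (Φ y - y)) ∧
      ∀ y, Injective (fderiv ℝ (fun y ↦ y + κ y • (Φ y - y)) y) := by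
  -- ### the two cut-offs and their derivative bounds
  let χ : ContDiffBump (0 : 𝔼 3) := ⟨1, 2, one_pos, by norm_num⟩
  have hχc : ContDiff ℝ ∞ χ := χ.contDiff
  obtain ⟨Cχ₀, hCχ₀⟩ := (χ.hasCompactSupport.fderiv ℝ).exists_bound_of_continuous
    (hχc.continuous_fderiv (by simp))
  set Cχ : ℝ := max Cχ₀ 0 with hCχ
  have hCχ0 : 0 ≤ Cχ := le_max_right _ _
  have hCχb : ∀ z, ‖fderiv ℝ χ z‖ ≤ Cχ := fun z ↦ (hCχ₀ z).trans (le_max_left _ _)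
  set ρ : ℝ → ℝ := segCutoff a b with hρ
  have hρc : ContDiff ℝ ∞ ρ := contDiff_segCutoff a b
  obtain ⟨Cρ, hCρ0, hCρb⟩ := exists_abs_deriv_le_of_eq_zero (hρc.of_le (by simp))
    (fun t ht ↦ segCutoff_of_le ht) (fun t ht ↦ segCutoff_of_ge ht)
  -- ### the smallness constant
  set ε₀ : ℝ := 1 / (2 * (1 + 2 * Cχ + 2 * Cρ)) with hε₀
  have hε₀0 : 0 < ε₀ := by positivity
  -- ### the tube where `‖DΦ - id‖ < ε₀`
  set g : 𝔼 3 × ℝ → 𝔼 3 × ℝ := fun y ↦ Φ y - y with hg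
  have hgV : ContDiffOn ℝ ∞ g V := hΦ.sub contDiffOn_id
  have hgd : ∀ z ∈ V, fderiv ℝ g z = fderiv ℝ Φ z - ContinuousLinearMap.id ℝ _ := by
    intro z hz
    have hFz : DifferentiableAt ℝ Φ z := (hΦ.contDiffAt (hV.mem_nhds hz)).differentiableAt (by simp)
    exact (hFz.hasFDerivAt.sub (hasFDerivAt_id z)).fderiv
  set W : Set (𝔼 3 × ℝ) := V ∩ (fun z ↦ fderiv ℝ Φ z) ⁻¹' {L | ‖L - ContinuousLinearMap.id ℝ _‖ < ε₀}
    with hW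
  have hWo : IsOpen W := by
    refine (hΦ.continuousOn_fderiv_of_isOpen hV (by simp)).isOpen_inter_preimage hV ?_
    exact isOpen_lt (continuous_id.sub continuous_const).norm continuous_const
  have hKW : ({x₀} : Set (𝔼 3)) ×ˢ Icc (a - 5 / 2) (b + 5 / 2) ⊆ W := by
    rintro ⟨x, t⟩ ⟨hx, ht⟩
    simp only [mem_singleton_iff] at hx
    simp only at ht
    subst x
    have ht' : t ∈ Icc (a - 3) (b + 3) := ⟨by linarith [ht.1], by linarith [ht.2]⟩
    refine ⟨hK t ht', ?_⟩
    show ‖fderiv ℝ Φ (x₀, t) - ContinuousLinearMap.id ℝ _‖ < ε₀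
    rw [hDΦ t ht', sub_self, norm_zero]; exact hε₀0
  obtain ⟨u, v, hu, hv, hxu, hIv, huv⟩ :=
    generalized_tube_lemma isCompact_singleton isCompact_Icc hWo hKW
  obtain ⟨ρ₁, hρ₁, hball⟩ := Metric.isOpen_iff.1 hu x₀ (hxu (mem_singleton x₀))
  -- ### the radius
  set r : ℝ := min (ρ₁ / 3) (min r₀ 1) with hr
  have hr0 : 0 < r := lt_min (by positivity) (lt_min hr₀ one_pos)
  have hrρ₁ : 2 * r < ρ₁ := by
    have : r ≤ ρ₁ / 3 := min_le_left _ _; linarith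
  have hrr₀ : r ≤ r₀ := (min_le_right _ _).trans (min_le_left _ _)
  have hr1 : r ≤ 1 := (min_le_right _ _).trans (min_le_right _ _)
  set T : Set (𝔼 3 × ℝ) := closedBall x₀ (2 * r) ×ˢ Icc (a - 5 / 2) (b + 5 / 2) with hT
  have hTW : T ⊆ W := fun y hy ↦ huv ⟨hball (closedBall_subset_ball hrρ₁ hy.1), hIv hy.2⟩
  have hTV : T ⊆ V := fun y hy ↦ (hTW hy).1
  have hTc : IsClosed T := isClosed_closedBall.prod isClosed_Icc
  have hTconv : Convex ℝ T := (convex_closedBall _ _).prod (convex_Icc _ _)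
  -- ### estimates of `g` on the tube
  have hDg : ∀ y ∈ T, ‖fderiv ℝ g y‖ ≤ ε₀ := by
    intro y hy
    rw [hgd y (hTV hy)]
    exact le_of_lt (hTW hy).2
  have hg_axis : ∀ t ∈ Icc (a - 5 / 2) (b + 5 / 2), g (x₀, t) = 0 := fun t ht ↦ by
    simp only [hg, hΦid t ⟨by linarith [ht.1], by linarith [ht.2]⟩, sub_self]
  have hgdiff : ∀ y ∈ T, DifferentiableAt ℝ g y := fun y hy ↦
    (hgV.contDiffAt (hV.mem_nhds (hTV hy))).differentiableAt (by simp)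
  have hg_le : ∀ y ∈ T, ‖g y‖ ≤ ε₀ * ‖y.1 - x₀‖ := by
    rintro ⟨x, t⟩ ⟨hx, ht⟩
    have h0 : ((x₀, t) : 𝔼 3 × ℝ) ∈ T := ⟨mem_closedBall_self (by positivity), ht⟩
    have := hTconv.norm_image_sub_le_of_norm_fderiv_le (fun y hy ↦ hgdiff y hy) hDg h0 ⟨hx, ht⟩
    rw [hg_axis t ht, sub_zero] at this
    refine this.trans (le_of_eq ?_)
    congr 1
    simp [Prod.norm_def]
  -- ### the cut-off `κ`
  set κ : 𝔼 3 × ℝ → ℝ := fun y ↦ χ (r⁻¹ • (y.1 - x₀)) * ρ y.2 with hκ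
  have hκc : ContDiff ℝ ∞ κ :=
    (hχc.comp ((contDiff_fst.sub contDiff_const).const_smul _)).mul (hρc.comp contDiff_snd)
  have hκmem : ∀ y, κ y ∈ Icc (0 : ℝ) 1 := fun y ↦
    ⟨mul_nonneg (χ.nonneg' _) (segCutoff_mem_Icc a b _).1,
      mul_le_one₀ χ.le_one (segCutoff_mem_Icc a b _).1 (segCutoff_mem_Icc a b _).2⟩
  have hκone : ∀ y : 𝔼 3 × ℝ, y.1 ∈ closedBall x₀ r → y.2 ∈ Icc (a - 1) (b + 1) → κ y = 1 := by
    intro y hy1 hy2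
    show (χ : 𝔼 3 → ℝ) (r⁻¹ • (y.1 - x₀)) * segCutoff a b y.2 = 1
    rw [segCutoff_eq_one hy2, mul_one]
    apply χ.one_of_mem_closedBall
    show r⁻¹ • (y.1 - x₀) ∈ closedBall (0 : 𝔼 3) 1
    rw [mem_closedBall, dist_zero_right, norm_smul, norm_inv, Real.norm_eq_abs, abs_of_pos hr0,
      inv_mul_le_iff₀ hr0, mul_one]
    rwa [mem_closedBall, dist_eq_norm] at hy1
  have hκsupp : ∀ y : 𝔼 3 × ℝ, κ y ≠ 0 → y.1 ∈ ball x₀ (2 * r) ∧ y.2 ∈ Ioo (a - 5 / 2) (b + 5 / 2) := by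
    intro y hy
    have h1 : (χ : 𝔼 3 → ℝ) (r⁻¹ • (y.1 - x₀)) ≠ 0 := left_ne_zero_of_mul hy
    have h2 : ρ y.2 ≠ 0 := right_ne_zero_of_mul hy
    refine ⟨?_, mem_Ioo_of_segCutoff_ne_zero h2⟩
    have : r⁻¹ • (y.1 - x₀) ∈ support (χ : 𝔼 3 → ℝ) := h1
    rw [χ.support_eq] at this
    change r⁻¹ • (y.1 - x₀) ∈ ball (0 : 𝔼 3) 2 at this
    rw [mem_ball, dist_zero_right, norm_smul, norm_inv, Real.norm_eq_abs, abs_of_pos hr0] at this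
    rw [mem_ball, dist_eq_norm]
    have := (inv_mul_lt_iff₀ hr0).1 this
    linarith
  have hκT : ∀ y, κ y ≠ 0 → y ∈ T := fun y hy ↦
    ⟨ball_subset_closedBall (hκsupp y hy).1, Ioo_subset_Icc_self (hκsupp y hy).2⟩
  -- the derivative of `κ`
  have hκderiv : ∀ y, ‖fderiv ℝ κ y‖ ≤ Cχ / r + Cρ := by
    intro y
    have hA : HasFDerivAt (fun y : 𝔼 3 × ℝ ↦ r⁻¹ • (y.1 - x₀))
        (r⁻¹ • ContinuousLinearMap.fst ℝ (𝔼 3) ℝ) y := by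
      have h0 : HasFDerivAt (fun y : 𝔼 3 × ℝ ↦ y.1 - x₀) (ContinuousLinearMap.fst ℝ (𝔼 3) ℝ) y :=
        (hasFDerivAt_fst (𝕜 := ℝ) (E := 𝔼 3) (F := ℝ) (p := y)).sub_const x₀
      exact h0.const_smul r⁻¹
    have h1 : HasFDerivAt (fun y : 𝔼 3 × ℝ ↦ (χ : 𝔼 3 → ℝ) (r⁻¹ • (y.1 - x₀)))
        ((fderiv ℝ χ (r⁻¹ • (y.1 - x₀))).comp (r⁻¹ • ContinuousLinearMap.fst ℝ (𝔼 3) ℝ)) y :=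
      ((hχc.differentiable (by simp)) _).hasFDerivAt.comp y hA
    have h2 : HasFDerivAt (fun y : 𝔼 3 × ℝ ↦ ρ y.2)
        (((1 : ℝ →L[ℝ] ℝ).smulRight (deriv ρ y.2)).comp (ContinuousLinearMap.snd ℝ (𝔼 3) ℝ)) y :=
      ((hρc.differentiable (by simp)) _).hasDerivAt.hasFDerivAt.comp y hasFDerivAt_snd
    have h : HasFDerivAt (fun y : 𝔼 3 × ℝ ↦ (χ : 𝔼 3 → ℝ) (r⁻¹ • (y.1 - x₀)) * ρ y.2)
        ((χ : 𝔼 3 → ℝ) (r⁻¹ • (y.1 - x₀)) •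
          (((1 : ℝ →L[ℝ] ℝ).smulRight (deriv ρ y.2)).comp (ContinuousLinearMap.snd ℝ (𝔼 3) ℝ)) +
          ρ y.2 • ((fderiv ℝ χ (r⁻¹ • (y.1 - x₀))).comp (r⁻¹ • ContinuousLinearMap.fst ℝ (𝔼 3) ℝ))) y :=
      h1.mul h2
    rw [show κ = fun y ↦ (χ : 𝔼 3 → ℝ) (r⁻¹ • (y.1 - x₀)) * ρ y.2 from rfl, h.fderiv]
    have hb1 : ‖(fderiv ℝ χ (r⁻¹ • (y.1 - x₀))).comp (r⁻¹ • ContinuousLinearMap.fst ℝ (𝔼 3) ℝ)‖ ≤ Cχ / r := by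
      refine (ContinuousLinearMap.opNorm_comp_le _ _).trans ?_
      rw [norm_smul, norm_inv, Real.norm_eq_abs, abs_of_pos hr0, div_eq_mul_inv]
      calc ‖fderiv ℝ χ (r⁻¹ • (y.1 - x₀))‖ * (r⁻¹ * ‖ContinuousLinearMap.fst ℝ (𝔼 3) ℝ‖)
          ≤ Cχ * (r⁻¹ * 1) := by
            gcongr
            · exact hCχb _
            · exact ContinuousLinearMap.norm_fst_le ℝ (𝔼 3) ℝ
        _ = Cχ * r⁻¹ := by ring
    have hb2 : ‖((1 : ℝ →L[ℝ] ℝ).smulRight (deriv ρ y.2)).comp (ContinuousLinearMap.snd ℝ (𝔼 3) ℝ)‖ ≤ Cρ := by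
      refine (ContinuousLinearMap.opNorm_comp_le _ _).trans ?_
      rw [ContinuousLinearMap.norm_smulRight_apply, norm_one, one_mul, Real.norm_eq_abs]
      calc |deriv ρ y.2| * ‖ContinuousLinearMap.snd ℝ (𝔼 3) ℝ‖ ≤ Cρ * 1 := by
            gcongr
            · exact hCρb _
            · exact ContinuousLinearMap.norm_snd_le ℝ (𝔼 3) ℝ
        _ = Cρ := mul_one _
    have hχ1 : ‖(χ : 𝔼 3 → ℝ) (r⁻¹ • (y.1 - x₀))‖ ≤ 1 := by
      rw [Real.norm_eq_abs, abs_of_nonneg (χ.nonneg' _)]; exact χ.le_one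
    have hρ1 : ‖ρ y.2‖ ≤ 1 := by
      rw [Real.norm_eq_abs, abs_of_nonneg (segCutoff_mem_Icc a b _).1]
      exact (segCutoff_mem_Icc a b _).2
    calc ‖(χ : 𝔼 3 → ℝ) (r⁻¹ • (y.1 - x₀)) •
          (((1 : ℝ →L[ℝ] ℝ).smulRight (deriv ρ y.2)).comp (ContinuousLinearMap.snd ℝ (𝔼 3) ℝ)) +
          ρ y.2 • ((fderiv ℝ χ (r⁻¹ • (y.1 - x₀))).comp (r⁻¹ • ContinuousLinearMap.fst ℝ (𝔼 3) ℝ))‖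
        ≤ ‖(χ : 𝔼 3 → ℝ) (r⁻¹ • (y.1 - x₀))‖ * ‖((1 : ℝ →L[ℝ] ℝ).smulRight (deriv ρ y.2)).comp
            (ContinuousLinearMap.snd ℝ (𝔼 3) ℝ)‖ +
          ‖ρ y.2‖ * ‖(fderiv ℝ χ (r⁻¹ • (y.1 - x₀))).comp (r⁻¹ • ContinuousLinearMap.fst ℝ (𝔼 3) ℝ)‖ := by
          refine (norm_add_le _ _).trans ?_
          rw [norm_smul, norm_smul]
      _ ≤ 1 * Cρ + 1 * (Cχ / r) := by gcongr
      _ = Cχ / r + Cρ := by ring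
  -- ### the perturbation `p = κ • g` and its derivative bound
  set p : 𝔼 3 × ℝ → 𝔼 3 × ℝ := fun y ↦ κ y • (Φ y - y) with hp
  have hpT : ∀ y ∉ T, p y = 0 := fun y hy ↦ by
    have : κ y = 0 := by by_contra h; exact hy (hκT y h)
    simp [hp, this]
  have hpc : ContDiff ℝ ∞ p := by
    rw [contDiff_iff_contDiffAt]
    intro y
    by_cases hy : y ∈ V
    · exact ((hκc.contDiffAt).smul (hgV.contDiffAt (hV.mem_nhds hy)))
    · have hyT : y ∉ T := fun h ↦ hy (hTV h)
      refine (contDiffAt_const (c := (0 : 𝔼 3 × ℝ))).congr_of_eventuallyEq ?_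
      filter_upwards [hTc.isOpen_compl.mem_nhds hyT] with z hz using hpT z hz
  have hpd : Differentiable ℝ p := hpc.differentiable (by simp)
  have hpb : ∀ y, ‖fderiv ℝ p y‖ ≤ 1 / 2 := by
    intro y
    by_cases hy : y ∈ T
    · have hκy := ((hκc.differentiable (by simp)) y).hasFDerivAt
      have hgy := (hgdiff y hy).hasFDerivAt
      have h : HasFDerivAt (fun y ↦ κ y • g y) (κ y • fderiv ℝ g y + (fderiv ℝ κ y).smulRight (g y)) y :=
        hκy.smul hgy
      rw [show p = fun y ↦ κ y • g y from rfl, h.fderiv]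
      have hκ1 : ‖κ y‖ ≤ 1 := by
        rw [Real.norm_eq_abs, abs_of_nonneg (hκmem y).1]; exact (hκmem y).2
      have hx2r : ‖y.1 - x₀‖ ≤ 2 * r := by
        have := hy.1; rwa [mem_closedBall, dist_eq_norm] at this
      calc ‖κ y • fderiv ℝ g y + (fderiv ℝ κ y).smulRight (g y)‖
          ≤ ‖κ y‖ * ‖fderiv ℝ g y‖ + ‖fderiv ℝ κ y‖ * ‖g y‖ := by
            refine (norm_add_le _ _).trans ?_
            rw [norm_smul, ContinuousLinearMap.norm_smulRight_apply]
        _ ≤ 1 * ε₀ + (Cχ / r + Cρ) * (ε₀ * ‖y.1 - x₀‖) := by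
            gcongr
            · exact hDg y hy
            · exact hκderiv y
            · exact hg_le y hy
        _ ≤ 1 * ε₀ + (Cχ / r + Cρ) * (ε₀ * (2 * r)) := by gcongr
        _ = ε₀ * (1 + 2 * Cχ + 2 * Cρ * r) := by field_simp; ring
        _ ≤ ε₀ * (1 + 2 * Cχ + 2 * Cρ) :=
            mul_le_mul_of_nonneg_left (by nlinarith [hr1, hCρ0.le]) hε₀0.le
        _ = 1 / 2 := by rw [hε₀]; field_simp
    · have hev : p =ᶠ[𝓝 y] fun _ ↦ (0 : 𝔼 3 × ℝ) := by
        filter_upwards [hTc.isOpen_compl.mem_nhds hy] with z hz using hpT z hz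
      rw [hev.fderiv_eq, fderiv_const_apply, norm_zero]
      norm_num
  refine ⟨r, κ, hr0, hrr₀, hTV, hκc, hκmem, hκone, hκsupp, contDiff_id.add hpc,
    injective_add_of_norm_fderiv_le hpd hpb, injective_fderiv_add_of_norm_fderiv_le hpd hpb⟩

end Literature.Topology.FourManifolds
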